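import Summits.AtomisticToContinuum.Crystallization.Theorems.FrustratedLawDichotomyStrainedPatchHomConvexSegmentW45

/-!
# SHUFFLE CONFINEMENT from ξ-convexity and slope bounds (first real brick of the ANALYTIC SLAB T″ of hand-1 g28 BUDGET-F §3/§6)

decomp-a2c hand-1 g28 (crux `AperiodicFrustratedLawGap`, stmt-AtomisticToContinuum-27623; `(H) HomFloor (1/625)`, hcp half).  BUDGET-F shows the hcp
certificate is affordable only if NON-EXEMPT shuffles are confined ANALYTICALLY (no force-prune leaves hugging the relaxed sheet): strong convexity of the
`B`-family energy in `ξ` along the segment `ξ₀ → ξ` plus slope bounds at both ends confine `‖U(ξ − ξ₀)‖`.  With the `hcurv` floor of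
`…HomConvexSegmentW45.hcpShifted_floor_W45` (`lam‖U(ξ−ξ₀)‖² ≤ Σ_b segGd …` off the junction radii), the slope bound `G₀` at `ξ₀` (the `hG` input — now
the centred `slopeCheckC`) and a slope bound `G₁` at `ξ` along the same direction:

  ★★ `shuffle_confine_W45`: `‖U(ξ − ξ₀)‖ ≤ (G₀ + G₁)/lam`,   ★ `slope_growth_W45`: `lam‖U(ξ−ξ₀)‖² ≤ Σ_b segG … 1 − Σ_b segG … 0`.

(The far-end slope `Σ_b segG (deriv W₄₅) (p_b(ξ₀)) (U(ξ−ξ₀)) 1` is the derivative at `ξ` of the `B`-family energy along `U(ξ−ξ₀)`; bounding it by the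
one-atom force cap of the exemption of record is the separate `W₄₅`-vs-LJ7 bridge of BUDGET-F §5.)

NO definitions; 0 sorry; standard axioms; no instances / notation / `#eval`.  `--supports stmt-AtomisticToContinuum-27623`.
-/

noncomputable section

namespace Summit.AtomisticToContinuum.Crystallization.Theorems.FrustratedLawDichotomyStrainedPatchHomConvexSegment

open scoped BigOperators
open Summit.AtomisticToContinuum.Crystallization.Theorems.FrustratedLawDichotomyStrainedPatchTaylorChord (segR segN segS segG segGd)
open Summit.AtomisticToContinuum.Crystallization.Theorems.ChargedEnergyGapNegative (E3)
open Summit.AtomisticToContinuum.Crystallization.Theorems.FrustratedLawDichotomyStrainedPatchHomSplit (latPt hexFrame hcpShift)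
open Summit.AtomisticToContinuum.Crystallization.Theorems.FrustratedLawDichotomyStrainedPatchEnvelopeTaylor (Wrec)
open Summit.AtomisticToContinuum.Crystallization.Theorems.FrustratedLawDichotomyStrainedPatchTaylorLeaves (junctions differentiableAt_Wrec)
open Summit.AtomisticToContinuum.Crystallization.Theorems.FrustratedLawDichotomyStrainedPatchTaylorRegular
  (continuousOn_deriv_Wrec differentiableAt_deriv_Wrec)
open Summit.AtomisticToContinuum.Crystallization.Theorems.FrustratedLawDichotomyStrainedPatchHomLatticeBoxHcp (norm_shifted_gt)

/-- ★ **SLOPE GROWTH along the shuffle segment** from the `hcurv` floor: `lam‖U(ξ−ξ₀)‖² ≤ Σ segG … 1 − Σ segG … 0`. [folklore chaining: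
`slope_growth_of_curvature_sum` on the `3/8`-tube of `hcpShifted_floor_W45`] -/
theorem slope_growth_W45 (B : Finset (Fin 3 → ℤ)) {U : E3 →L[ℝ] E3} (hU : ‖U - 1‖ ≤ 1 / 4) {ξ₀ ξ : E3} (hξ₀ : ‖ξ₀‖ ≤ 1 / 4) (hξ : ‖ξ‖ ≤ 1 / 4)
    {lam : ℝ}
    (hcurv : ∀ s ∈ Set.Ioo (0 : ℝ) 1,
      (∀ bb ∈ B, segR (latPt U hexFrame bb + U (hcpShift + ξ₀)) (U (ξ - ξ₀)) s ∉ junctions) →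
      lam * ‖U (ξ - ξ₀)‖ ^ 2 ≤ ∑ bb ∈ B, segGd (deriv Wrec) (latPt U hexFrame bb + U (hcpShift + ξ₀)) (U (ξ - ξ₀)) s) :
    lam * ‖U (ξ - ξ₀)‖ ^ 2 ≤ ∑ bb ∈ B, segG (deriv Wrec) (latPt U hexFrame bb + U (hcpShift + ξ₀)) (U (ξ - ξ₀)) 1 -
      ∑ bb ∈ B, segG (deriv Wrec) (latPt U hexFrame bb + U (hcpShift + ξ₀)) (U (ξ - ξ₀)) 0 := by
  by_cases hΔ : U (ξ - ξ₀) = 0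
  · -- degenerate direction: both slopes vanish
    have hz : ∀ (q : E3) (s : ℝ), segG (deriv Wrec) q (0 : E3) s = 0 := fun q s => by simp [segG, segS, segN]
    rw [hΔ]
    simp [hz]
  set p : (Fin 3 → ℤ) → E3 := fun bb => latPt U hexFrame bb + U (hcpShift + ξ₀) with hp
  set Δ : E3 := U (ξ - ξ₀) with hΔdef
  set bhi : ℝ := (∑ bb ∈ B, ‖p bb‖) + ‖Δ‖ + 1 with hbhi
  have hseg : ∀ bb : Fin 3 → ℤ, ∀ s : ℝ, p bb + s • Δ = latPt U hexFrame bb + U (hcpShift + (ξ₀ + s • (ξ - ξ₀))) := by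
    intro bb s
    simp only [hp, hΔdef, map_add, map_smul]
    abel
  have htube : ∀ bb ∈ B, ∀ s ∈ Set.Icc (0 : ℝ) 1, 3 / 8 ≤ ‖p bb + s • Δ‖ ∧ ‖p bb + s • Δ‖ ≤ bhi := by
    intro bb hbb s hs
    constructor
    · rw [hseg]
      exact (norm_shifted_gt hU (norm_shuffle_segment_le hξ₀ hξ hs) bb).le
    · have h1 : ‖p bb + s • Δ‖ ≤ ‖p bb‖ + ‖Δ‖ := by
        calc ‖p bb + s • Δ‖ ≤ ‖p bb‖ + ‖s • Δ‖ := norm_add_le _ _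
          _ ≤ ‖p bb‖ + ‖Δ‖ := by
              rw [norm_smul, Real.norm_eq_abs, abs_of_nonneg hs.1]
              nlinarith [norm_nonneg Δ, hs.2]
      have h2 : ‖p bb‖ ≤ ∑ bb ∈ B, ‖p bb‖ := Finset.single_le_sum (fun _ _ => norm_nonneg _) hbb
      rw [hbhi]; linarith
  have ha : (0 : ℝ) < 3 / 8 := by norm_num
  have hcont : ContinuousOn (deriv Wrec) (Set.Icc (3 / 8) bhi) := continuousOn_deriv_Wrec.mono fun r hr => ha.trans_le hr.1
  have hdiff : ∀ r, (3 : ℝ) / 8 < r → r < bhi → r ∉ junctions → HasDerivAt (deriv Wrec) (deriv (deriv Wrec) r) r :=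
    fun r hr _ hJ => (differentiableAt_deriv_Wrec (ha.trans hr) hJ).hasDerivAt
  have hcurv' : ∀ s ∈ Set.Ioo (0 : ℝ) 1, (∀ bb ∈ B, 3 / 8 < segR (p bb) Δ s ∧ segR (p bb) Δ s < bhi ∧ segR (p bb) Δ s ∉ junctions) →
      lam * ‖Δ‖ ^ 2 ≤ ∑ bb ∈ B, segGd (deriv Wrec) (p bb) Δ s :=
    fun s hs hgood => hcurv s hs fun bb hbb => (hgood bb hbb).2.2
  have key := slope_growth_of_curvature_sum B p hΔ junctions ha hcont hdiff htube hcurv' 1 ⟨zero_le_one, le_rfl⟩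
  rw [mul_one] at key
  linarith

/-- ★★ **SHUFFLE CONFINEMENT**: ξ-convexity `lam` along the segment, slope `≤ G₀‖U(ξ−ξ₀)‖` at `ξ₀` and `≤ G₁‖U(ξ−ξ₀)‖` at `ξ` (same direction; `G₀ + G₁ ≥ 0`) ⟹
`‖U(ξ − ξ₀)‖ ≤ (G₀ + G₁)/lam`. [folklore: strong monotonicity of the gradient of a uniformly convex function] -/
theorem shuffle_confine_W45 (B : Finset (Fin 3 → ℤ)) {U : E3 →L[ℝ] E3} (hU : ‖U - 1‖ ≤ 1 / 4) {ξ₀ ξ : E3} (hξ₀ : ‖ξ₀‖ ≤ 1 / 4) (hξ : ‖ξ‖ ≤ 1 / 4)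
    {lam G₀ G₁ : ℝ} (hlam : 0 < lam) (hGnn : 0 ≤ G₀ + G₁)
    (hcurv : ∀ s ∈ Set.Ioo (0 : ℝ) 1,
      (∀ bb ∈ B, segR (latPt U hexFrame bb + U (hcpShift + ξ₀)) (U (ξ - ξ₀)) s ∉ junctions) →
      lam * ‖U (ξ - ξ₀)‖ ^ 2 ≤ ∑ bb ∈ B, segGd (deriv Wrec) (latPt U hexFrame bb + U (hcpShift + ξ₀)) (U (ξ - ξ₀)) s)
    (hG0 : |∑ bb ∈ B, segG (deriv Wrec) (latPt U hexFrame bb + U (hcpShift + ξ₀)) (U (ξ - ξ₀)) 0| ≤ G₀ * ‖U (ξ - ξ₀)‖)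
    (hG1 : |∑ bb ∈ B, segG (deriv Wrec) (latPt U hexFrame bb + U (hcpShift + ξ₀)) (U (ξ - ξ₀)) 1| ≤ G₁ * ‖U (ξ - ξ₀)‖) :
    ‖U (ξ - ξ₀)‖ ≤ (G₀ + G₁) / lam := by
  have hgrow := slope_growth_W45 B hU hξ₀ hξ hcurv
  set n := ‖U (ξ - ξ₀)‖ with hn
  have hn0 : 0 ≤ n := norm_nonneg _
  have h0 := (abs_le.1 hG0).1
  have h1 := (abs_le.1 hG1).2
  have hq : lam * n ^ 2 ≤ (G₀ + G₁) * n := by nlinarith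
  rw [le_div_iff₀ hlam]
  by_cases hz : n = 0
  · rw [hz]; simpa using hGnn
  · have hpos : 0 < n := lt_of_le_of_ne hn0 (Ne.symm hz)
    have h3 : lam * n * n ≤ (G₀ + G₁) * n := by nlinarith
    have h4 : lam * n ≤ G₀ + G₁ := le_of_mul_le_mul_right h3 hpos
    linarith

end Summit.AtomisticToContinuum.Crystallization.Theorems.FrustratedLawDichotomyStrainedPatchHomConvexSegment

end
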